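import Literature.NumberTheory.Weil1964.AdelicDoublingGeometricFrame
import Literature.NumberTheory.Weil1964.AdelicDoublingOriginValueInvariance
import Literature.NumberTheory.Automorphic.SiegelEisensteinRationalInvariance
import HarnessLib

/-!
# The geometric frame of the doubling diagonal as a group element, and the rational invariance of frame-read functionals

Topic `NumberTheory/Weil1964`; namespace `Literature.NumberTheory.Weil1964.DoublingFrame`.  KERNEL file: theorems over existing tree
declarations (no `def`, no `def … : Prop`, no notation, no `sorry`).  Sequel of ★ `AdelicDoublingGeometricFrame` (the frame
`Ψ ↦ Ψ♮ = t(C₀)(ω(r_F δ)Ψ)`, `geomFrame`), ★ `AdelicDoublingOriginValueInvariance` (the Siegel–Weil section value is fixed by the rational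
stabiliser of the diagonal Lagrangian) and ★ `SiegelEisensteinRationalInvariance` (the Eisenstein coset sum is invariant under the rational
group).  Setting: a number field `F`, an adelic Gram matrix `T` with `IsUnit T.det`, the doubled space `𝕎□_𝔸` of Gram matrix
`𝕋 = doubledGramFin F T`, Weil's lift `r_F = ratThetaLiftCont F 𝕋 _` of the rational symplectic group `Sp_{2(n+n)}(F)`, Li's rational `δ`
(`doublingDeltaRat`, `r_F δ = doublingDeltaLift`).

THE PRINT.  [Weil1964, Chap. I n° 13 p. 160]: Weil's `𝐫₀` on the Siegel parabolic, `t₀(f)` the operator of a unipotent pair; [Weil1965,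
n° 39 (30) p. 57 and n° 41]: the Eisenstein–Siegel series `E(Φ) = Σ_{P(k)\G(k)} (r(γ)Φ)(0)` is a `G(k)`-invariant tempered distribution, and so is
every difference `E′ − κE` with another `G(k)`-invariant functional `E′` (n° 51: «`E″ = E′ − E`»); in n° 52 both are read in the frame
`X = V ⊗ ℓ*` of the doubled space, where the diagonal acts geometrically.
* §1 (the frame as a GROUP element): for any `u₀ ∈ Mp_ψ(𝕎□_𝔸)ᶜᵒⁿᵗ` whose Weil operator is the frame chirp `t(C₀)` (hypothesis `hu₀`, the
  binder of ★-track `AdelicDoublingGeometricFrameBorelMp.exists_frameUnipPair`): `Ψ♮ = ω(u₀ · r_F δ)Ψ` (`geomFrame_eq_omega_mul`), the frame is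
  onto (`exists_eq_geomFrame`), and for `r := u₀ · r_F(δ γ δ⁻¹) · u₀⁻¹`, `γ ∈ Sp_{2(n+n)}(F)`: **`ω(r⁻¹) Ψ♮ = (ω(r_F γ⁻¹)Ψ)♮`**
  (`omega_inv_conj_geomFrame`).
* §2 (the Eisenstein half): for subgroups `H, P ≤ Sp_{2(n+n)}(F)` with `ratSp(δ p δ⁻¹) ∈ P_𝕐(𝔸)` for `p ∈ P` (`hP`), the coset sum
  `E(Ψ) = Σ'_{q ∈ H/(P ⊓ H)} ev₀(ω(r_F q̃⁻¹)Ψ)`, `ev₀(Ψ) = (ω(r_F δ)Ψ)(0)`, satisfies **`E(ω(r_F γ)Ψ) = E(Ψ)` for `γ ∈ H`**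
  (`tsum_eisTerm_omega_ratThetaLiftCont`, `Summable ↔`), NO summability hypothesis.
* §3 (frame transfer, abstract): two functionals `I, Eis` invariant under `ω(r_F γ⁻¹)` and read in the frame through linear `EI, EE` as
  `I Ψ = κ₀·Ψ♮(0) + EI(Ψ♮)`, `Eis Ψ = Ψ♮(0) + EE(Ψ♮)` give **`(EI − κ₀ • EE) ∘ ω(r⁻¹) = EI − κ₀ • EE`** (`sub_smul_comp_omega_inv_conj_eq_of_frame`):
  both rank-0 terms cancel.

Written for the Hodge-CM cell `pub/hodgecm-mathlib`, floor 0, crux H413 (stmt-HodgeConjecture-24833), E-2 child line `F0_E2SiegelWeilWeilRange`,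
row (INV-E″) of the sheets `F0/P4/SW2c-BOUND-ASSEMBLY.v1` §B / `SW2-ICLOSE-ASSEMBLY.v0` §1 (INV-δ); seat F0P4-p02 (g4), 2026-08-31.  The dual-pair
consumer is `Summits/HodgeConjecture/HodgeConjecture/Theorems/H413E2SWEInvariance.lean`.  HC_CM is proved only modulo the printed citations until
rung 0 closes; nothing here bears on a summit statement.

## References
* [Weil1964] A. Weil, *Sur certains groupes d'opérateurs unitaires*, Acta Math. 111 (1964), Chap. I n° 13 p. 160, Chap. III n° 40–41 Thm 6 p. 193.
* [Weil1965] A. Weil, *Sur la formule de Siegel dans la théorie des groupes classiques*, Acta Math. 113 (1965), n° 39 (30) p. 57, n° 41, n° 51–52.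
* [Kudla1994] S. Kudla, *Splitting metaplectic covers of dual reductive pairs*, Israel J. Math. 87 (1994) 361–401, §3.
* [Li1992] J.-S. Li, J. reine angew. Math. 428 (1992) 177–217, p. 181 (the element `δ`).
-/

set_option autoImplicit false

noncomputable section

open NumberField
open Literature.RepresentationTheory.HeisenbergGroup
open Literature.NumberTheory.Automorphic

namespace Literature.NumberTheory.Weil1964.DoublingFrame

/-! ## §1 Group algebra in `Mp_ψ(𝕎□_𝔸)ᶜᵒⁿᵗ`: the geometric frame as `ω(u₀ · r_F δ)` and the conjugated rational lifts through it -/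

section Frame

variable (F : Type) [Field F] [NumberField F] {n : ℕ}
  (T : Matrix (Fin n) (Fin n) (AdeleRing (𝓞 F) F)) (hT : IsUnit T.det)
  (u₀ : adelicMpCont F (Fin (n + n)) (doubledGramFin F T))
  (hu₀ : ∀ Φ : piSchwartzBruhat F (Fin (n + n)),
    ((adelicMpCont.omega F (Fin (n + n)) (doubledGramFin F T) u₀ Φ : piSchwartzBruhat F (Fin (n + n))) :
        (Fin (n + n) → AdeleRing (𝓞 F) F) → ℂ) =
      chirp F (ratMatrix F (frameHalfRat F)) (Φ : (Fin (n + n) → AdeleRing (𝓞 F) F) → ℂ))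

/-- `ω(p q)Ψ = ω(p)(ω(q)Ψ)` on `𝒮(X□(𝔸))`: the Weil representation of `Mp_ψ(𝕎□_𝔸)ᶜᵒⁿᵗ` is a homomorphism. [cite: Weil1964, Chap. I n° 13 p. 160] -/
theorem omega_mul_apply (p q : adelicMpCont F (Fin (n + n)) (doubledGramFin F T)) (Ψ : piSchwartzBruhat F (Fin (n + n))) :
    adelicMpCont.omega F (Fin (n + n)) (doubledGramFin F T) (p * q) Ψ =
      adelicMpCont.omega F (Fin (n + n)) (doubledGramFin F T) p (adelicMpCont.omega F (Fin (n + n)) (doubledGramFin F T) q Ψ) :=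
  LinearMap.congr_fun (map_mul (adelicMpCont.omega F (Fin (n + n)) (doubledGramFin F T)) p q) Ψ

/-- `ω((u x u⁻¹)⁻¹)(ω(u y)Ψ) = ω(u (x⁻¹ y))Ψ`: conjugated inverses act through the frame `u`. [cite: Weil1964, Chap. I n° 13 p. 160] -/
theorem omega_inv_conj_omega_mul_apply (u x y : adelicMpCont F (Fin (n + n)) (doubledGramFin F T))
    (Ψ : piSchwartzBruhat F (Fin (n + n))) :
    adelicMpCont.omega F (Fin (n + n)) (doubledGramFin F T) (u * x * u⁻¹)⁻¹
        (adelicMpCont.omega F (Fin (n + n)) (doubledGramFin F T) (u * y) Ψ) =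
      adelicMpCont.omega F (Fin (n + n)) (doubledGramFin F T) (u * (x⁻¹ * y)) Ψ := by
  have hg : (u * x * u⁻¹)⁻¹ * (u * y) = u * (x⁻¹ * y) := by group
  exact (omega_mul_apply F T _ _ Ψ).symm.trans
    (congrArg (fun z => adelicMpCont.omega F (Fin (n + n)) (doubledGramFin F T) z Ψ) hg)

include hu₀ in
/-- **the geometric frame is `ω(u₀ · r_F δ)`**: `Ψ♮ = t(C₀)(ω(r_F δ)Ψ) = ω(u₀)(ω(r_F δ)Ψ)` for A-p12's frame pair `u₀`
(`ω(u₀) = t(C₀)` on functions). [cite: Weil1964, Chap. I n° 13 p. 160] [cite: Weil1965, n° 52] -/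
theorem geomFrame_eq_omega_mul (Ψ : piSchwartzBruhat F (Fin (n + n))) :
    geomFrame F T hT Ψ =
      adelicMpCont.omega F (Fin (n + n)) (doubledGramFin F T) (u₀ * doublingDeltaLift F T hT) Ψ := by
  refine Subtype.ext ?_
  refine (coe_geomFrame F T hT Ψ).trans ?_
  refine (hu₀ (adelicMpCont.omega F (Fin (n + n)) (doubledGramFin F T) (doublingDeltaLift F T hT) Ψ)).symm.trans ?_
  exact congrArg (fun Φ : piSchwartzBruhat F (Fin (n + n)) => ((Φ : piSchwartzBruhat F (Fin (n + n))) :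
      (Fin (n + n) → AdeleRing (𝓞 F) F) → ℂ))
    (omega_mul_apply F T u₀ (doublingDeltaLift F T hT) Ψ).symm

/-- `ω(p)(ω(p⁻¹)Φ) = Φ`. [cite: Weil1964, Chap. I n° 13 p. 160] -/
theorem omega_apply_omega_inv_apply (p : adelicMpCont F (Fin (n + n)) (doubledGramFin F T))
    (Φ : piSchwartzBruhat F (Fin (n + n))) :
    adelicMpCont.omega F (Fin (n + n)) (doubledGramFin F T) p
        (adelicMpCont.omega F (Fin (n + n)) (doubledGramFin F T) p⁻¹ Φ) = Φ :=
  ((omega_mul_apply F T p p⁻¹ Φ).symm.trans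
      (congrArg (fun z => adelicMpCont.omega F (Fin (n + n)) (doubledGramFin F T) z Φ) (mul_inv_cancel p))).trans
    (LinearMap.congr_fun (map_one (adelicMpCont.omega F (Fin (n + n)) (doubledGramFin F T))) Φ)

include hu₀ in
/-- **the geometric frame is onto**: every `Φ ∈ 𝒮(X□(𝔸))` is `Ψ♮` for `Ψ := ω((u₀ · r_F δ)⁻¹)Φ`. [cite: Weil1965, n° 52] -/
theorem exists_eq_geomFrame (Φ : piSchwartzBruhat F (Fin (n + n))) :
    ∃ Ψ : piSchwartzBruhat F (Fin (n + n)), Φ = geomFrame F T hT Ψ := by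
  refine ⟨adelicMpCont.omega F (Fin (n + n)) (doubledGramFin F T) (u₀ * doublingDeltaLift F T hT)⁻¹ Φ, ?_⟩
  refine Eq.trans ?_ (geomFrame_eq_omega_mul F T hT u₀ hu₀
    (adelicMpCont.omega F (Fin (n + n)) (doubledGramFin F T) (u₀ * doublingDeltaLift F T hT)⁻¹ Φ)).symm
  exact (omega_apply_omega_inv_apply F T (u₀ * doublingDeltaLift F T hT) Φ).symm

/-- `r_F(δ γ δ⁻¹) = r_F(δ) · r_F(γ) · r_F(δ)⁻¹` with `r_F(δ) = doublingDeltaLift` (definitional). [cite: Weil1964, Chap. III n° 40 p. 190] -/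
theorem ratThetaLiftCont_conj_doublingDeltaRat (γ : Matrix.symplecticGroup (Fin (n + n)) F) :
    ratThetaLiftCont F (doubledGramFin F T) (isUnit_det_doubledGramFin F T hT)
        (doublingDeltaRat F * γ * (doublingDeltaRat F)⁻¹) =
      doublingDeltaLift F T hT * ratThetaLiftCont F (doubledGramFin F T) (isUnit_det_doubledGramFin F T hT) γ *
        (doublingDeltaLift F T hT)⁻¹ := by
  unfold doublingDeltaLift
  have h1 := map_mul (ratThetaLiftCont F (doubledGramFin F T) (isUnit_det_doubledGramFin F T hT))
    (doublingDeltaRat F * γ) (doublingDeltaRat F)⁻¹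
  have h2 := map_mul (ratThetaLiftCont F (doubledGramFin F T) (isUnit_det_doubledGramFin F T hT)) (doublingDeltaRat F) γ
  have h3 := map_inv (ratThetaLiftCont F (doubledGramFin F T) (isUnit_det_doubledGramFin F T hT)) (doublingDeltaRat F)
  exact h1.trans (congrArg₂ (· * ·) h2 h3)

/-- group algebra: `(a X a⁻¹)⁻¹ (a d) = a d g⁻¹` when `X = d g d⁻¹`. [folklore] -/
private theorem inv_conj_mul_eq_of_eq_conj {G : Type*} [Group G] (a d g X : G) (hX : X = d * g * d⁻¹) :
    (a * X * a⁻¹)⁻¹ * (a * d) = a * d * g⁻¹ := by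
  subst hX
  group

include hu₀ in
/-- **THE CONJUGATED RATIONAL LIFT THROUGH THE FRAME**: for `r := u₀ · r_F(δ γ δ⁻¹) · u₀⁻¹` (the junction's lift of the
`δ♮`-conjugate of a rational symplectic `γ`, `δ♮ = π(u₀)·δ`), `ω(r⁻¹) Ψ♮ = (ω(r_F γ⁻¹) Ψ)♮`. [cite: Weil1964, Chap. I n° 13 p. 160 and Chap. III n° 40 p. 190] -/
theorem omega_inv_conj_geomFrame (γ : Matrix.symplecticGroup (Fin (n + n)) F) (Ψ : piSchwartzBruhat F (Fin (n + n))) :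
    adelicMpCont.omega F (Fin (n + n)) (doubledGramFin F T)
        (u₀ * ratThetaLiftCont F (doubledGramFin F T) (isUnit_det_doubledGramFin F T hT)
            (doublingDeltaRat F * γ * (doublingDeltaRat F)⁻¹) * u₀⁻¹)⁻¹ (geomFrame F T hT Ψ) =
      geomFrame F T hT (adelicMpCont.omega F (Fin (n + n)) (doubledGramFin F T)
        (ratThetaLiftCont F (doubledGramFin F T) (isUnit_det_doubledGramFin F T hT) γ⁻¹) Ψ) := by
  -- the group identity `r⁻¹ · (u₀ · r_F δ) = (u₀ · r_F δ) · r_F(γ⁻¹)` in `Mp_ψ(𝕎□_𝔸)ᶜᵒⁿᵗ`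
  have hg : (u₀ * ratThetaLiftCont F (doubledGramFin F T) (isUnit_det_doubledGramFin F T hT)
        (doublingDeltaRat F * γ * (doublingDeltaRat F)⁻¹) * u₀⁻¹)⁻¹ * (u₀ * doublingDeltaLift F T hT) =
      u₀ * doublingDeltaLift F T hT *
        ratThetaLiftCont F (doubledGramFin F T) (isUnit_det_doubledGramFin F T hT) γ⁻¹ :=
    (inv_conj_mul_eq_of_eq_conj u₀ (doublingDeltaLift F T hT)
        (ratThetaLiftCont F (doubledGramFin F T) (isUnit_det_doubledGramFin F T hT) γ) _
        (ratThetaLiftCont_conj_doublingDeltaRat F T hT γ)).trans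
      (congrArg (u₀ * doublingDeltaLift F T hT * ·)
        (map_inv (ratThetaLiftCont F (doubledGramFin F T) (isUnit_det_doubledGramFin F T hT)) γ).symm)
  -- `ω(r⁻¹) Ψ♮ = ω(r⁻¹)(ω(u₀ r_F δ)Ψ) = ω(r⁻¹ · u₀ r_F δ)Ψ = ω(u₀ r_F δ · r_F γ⁻¹)Ψ = (ω(r_F γ⁻¹)Ψ)♮`
  have h1 : adelicMpCont.omega F (Fin (n + n)) (doubledGramFin F T)
        (u₀ * ratThetaLiftCont F (doubledGramFin F T) (isUnit_det_doubledGramFin F T hT)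
            (doublingDeltaRat F * γ * (doublingDeltaRat F)⁻¹) * u₀⁻¹)⁻¹ (geomFrame F T hT Ψ) =
      adelicMpCont.omega F (Fin (n + n)) (doubledGramFin F T)
        (u₀ * ratThetaLiftCont F (doubledGramFin F T) (isUnit_det_doubledGramFin F T hT)
            (doublingDeltaRat F * γ * (doublingDeltaRat F)⁻¹) * u₀⁻¹)⁻¹
        (adelicMpCont.omega F (Fin (n + n)) (doubledGramFin F T) (u₀ * doublingDeltaLift F T hT) Ψ) :=
    congrArg (fun Φ : piSchwartzBruhat F (Fin (n + n)) => adelicMpCont.omega F (Fin (n + n)) (doubledGramFin F T)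
        (u₀ * ratThetaLiftCont F (doubledGramFin F T) (isUnit_det_doubledGramFin F T hT)
            (doublingDeltaRat F * γ * (doublingDeltaRat F)⁻¹) * u₀⁻¹)⁻¹ Φ)
      (geomFrame_eq_omega_mul F T hT u₀ hu₀ Ψ)
  have h2 := (omega_mul_apply F T
    (u₀ * ratThetaLiftCont F (doubledGramFin F T) (isUnit_det_doubledGramFin F T hT)
        (doublingDeltaRat F * γ * (doublingDeltaRat F)⁻¹) * u₀⁻¹)⁻¹ (u₀ * doublingDeltaLift F T hT) Ψ).symm
  have h3 := congrArg (fun z => adelicMpCont.omega F (Fin (n + n)) (doubledGramFin F T) z Ψ) hg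
  have h4 := omega_mul_apply F T (u₀ * doublingDeltaLift F T hT)
    (ratThetaLiftCont F (doubledGramFin F T) (isUnit_det_doubledGramFin F T hT) γ⁻¹) Ψ
  have h5 := (geomFrame_eq_omega_mul F T hT u₀ hu₀ (adelicMpCont.omega F (Fin (n + n)) (doubledGramFin F T)
    (ratThetaLiftCont F (doubledGramFin F T) (isUnit_det_doubledGramFin F T hT) γ⁻¹) Ψ)).symm
  exact h1.trans (h2.trans (h3.trans (h4.trans h5)))

end Frame

/-! ## §2 The Eisenstein half: `E(ω(r_F γ)Ψ) = E(Ψ)` for `γ` in any subgroup `H` of rational symplectic matrices -/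

section Eisenstein

variable (F : Type) [Field F] [NumberField F] {n : ℕ}
  (T : Matrix (Fin n) (Fin n) (AdeleRing (𝓞 F) F)) (hT : IsUnit T.det)
  (H P : Subgroup (Matrix.symplecticGroup (Fin (n + n)) F))
  (hP : ∀ p ∈ P, ratSp F (doubledGramFin F T) (isUnit_det_doubledGramFin F T hT)
      (doublingDeltaRat F * p * (doublingDeltaRat F)⁻¹) ∈ siegelParabolicPi (doubledGramFin F T))

/-- `r_F^□(ab) · Ψ = r_F^□(a) · (r_F^□(b) · Ψ)` — the child's `actRat_mul`, unfolded (`hmul` of ★ `SiegelEisenstein.tsum_quotient_act_eq`).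
[cite: Weil1964, Chap. III n° 40 p. 190] -/
theorem omega_ratThetaLiftCont_mul_apply (a b : Matrix.symplecticGroup (Fin (n + n)) F) (Ψ : piSchwartzBruhat F (Fin (n + n))) :
    adelicMpCont.omega F (Fin (n + n)) (doubledGramFin F T)
        (ratThetaLiftCont F (doubledGramFin F T) (isUnit_det_doubledGramFin F T hT) (a * b)) Ψ =
      adelicMpCont.omega F (Fin (n + n)) (doubledGramFin F T)
        (ratThetaLiftCont F (doubledGramFin F T) (isUnit_det_doubledGramFin F T hT) a)
        (adelicMpCont.omega F (Fin (n + n)) (doubledGramFin F T)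
          (ratThetaLiftCont F (doubledGramFin F T) (isUnit_det_doubledGramFin F T hT) b) Ψ) :=
  (congrArg (fun z => adelicMpCont.omega F (Fin (n + n)) (doubledGramFin F T) z Ψ)
      (map_mul (ratThetaLiftCont F (doubledGramFin F T) (isUnit_det_doubledGramFin F T hT)) a b)).trans
    (omega_mul_apply F T _ _ Ψ)

include hP in
/-- **the Siegel–Eisenstein carrier** `ev₀(r_F^□(p) · Ψ) = ev₀(Ψ)` for `p ∈ P` (`hP`: `δpδ⁻¹` lies over `P_𝕐(𝔸)`) — ★
`omega_doublingDeltaLift_omega_ratThetaLiftCont_apply_zero`; the child's `stub_SW2i_carrier` at `P := stabDiagRat`. [cite: Weil1965, n° 39 (30) p. 57] [cite: Li1992, p. 181] -/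
theorem apply_zero_omega_doublingDeltaLift_omega_ratThetaLiftCont_of_mem {p : Matrix.symplecticGroup (Fin (n + n)) F} (hp : p ∈ P)
    (Ψ : piSchwartzBruhat F (Fin (n + n))) :
    ((adelicMpCont.omega F (Fin (n + n)) (doubledGramFin F T) (doublingDeltaLift F T hT)
          (adelicMpCont.omega F (Fin (n + n)) (doubledGramFin F T)
            (ratThetaLiftCont F (doubledGramFin F T) (isUnit_det_doubledGramFin F T hT) p) Ψ) :
          piSchwartzBruhat F (Fin (n + n))) : (Fin (n + n) → AdeleRing (𝓞 F) F) → ℂ) 0 =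
      ((adelicMpCont.omega F (Fin (n + n)) (doubledGramFin F T) (doublingDeltaLift F T hT) Ψ :
          piSchwartzBruhat F (Fin (n + n))) : (Fin (n + n) → AdeleRing (𝓞 F) F) → ℂ) 0 :=
  omega_doublingDeltaLift_omega_ratThetaLiftCont_apply_zero F T hT p (hP p hp) Ψ

include hP in
/-- **THE EISENSTEIN HALF** `E(ω(r_F γ)Ψ) = E(Ψ)` for `γ ∈ H`, `E(Ψ) = Σ'_{q ∈ H/(P ⊓ H)} ev₀(ω(r_F q̃⁻¹)Ψ)` — the child's
`eis (actRat …) H P (ev0 …)` unfolded; ★ `SiegelEisenstein.tsum_quotient_act_eq_of_mem`, NO summability hypothesis.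
[cite: Weil1965, n° 39 (30) p. 57] [cite: Kudla1994, §3] -/
theorem tsum_eisTerm_omega_ratThetaLiftCont {γ : Matrix.symplecticGroup (Fin (n + n)) F} (hγ : γ ∈ H)
    (Ψ : piSchwartzBruhat F (Fin (n + n))) :
    ∑' q : H ⧸ P.subgroupOf H,
        ((adelicMpCont.omega F (Fin (n + n)) (doubledGramFin F T) (doublingDeltaLift F T hT)
            (adelicMpCont.omega F (Fin (n + n)) (doubledGramFin F T)
              (ratThetaLiftCont F (doubledGramFin F T) (isUnit_det_doubledGramFin F T hT)
                ((Quotient.out q : H) : Matrix.symplecticGroup (Fin (n + n)) F)⁻¹)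
              (adelicMpCont.omega F (Fin (n + n)) (doubledGramFin F T)
                (ratThetaLiftCont F (doubledGramFin F T) (isUnit_det_doubledGramFin F T hT) γ) Ψ)) :
            piSchwartzBruhat F (Fin (n + n))) : (Fin (n + n) → AdeleRing (𝓞 F) F) → ℂ) 0 =
      ∑' q : H ⧸ P.subgroupOf H,
        ((adelicMpCont.omega F (Fin (n + n)) (doubledGramFin F T) (doublingDeltaLift F T hT)
            (adelicMpCont.omega F (Fin (n + n)) (doubledGramFin F T)
              (ratThetaLiftCont F (doubledGramFin F T) (isUnit_det_doubledGramFin F T hT)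
                ((Quotient.out q : H) : Matrix.symplecticGroup (Fin (n + n)) F)⁻¹) Ψ) :
            piSchwartzBruhat F (Fin (n + n))) : (Fin (n + n) → AdeleRing (𝓞 F) F) → ℂ) 0 :=
  SiegelEisenstein.tsum_quotient_act_eq_of_mem
    (fun (a : Matrix.symplecticGroup (Fin (n + n)) F) (Φ : piSchwartzBruhat F (Fin (n + n))) =>
      adelicMpCont.omega F (Fin (n + n)) (doubledGramFin F T)
        (ratThetaLiftCont F (doubledGramFin F T) (isUnit_det_doubledGramFin F T hT) a) Φ)
    H P
    (fun Φ : piSchwartzBruhat F (Fin (n + n)) =>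
      ((adelicMpCont.omega F (Fin (n + n)) (doubledGramFin F T) (doublingDeltaLift F T hT) Φ :
        piSchwartzBruhat F (Fin (n + n))) : (Fin (n + n) → AdeleRing (𝓞 F) F) → ℂ) 0)
    (omega_ratThetaLiftCont_mul_apply F T hT)
    (fun _ hp Φ => apply_zero_omega_doublingDeltaLift_omega_ratThetaLiftCont_of_mem F T hT P hP hp Φ) hγ Ψ

include hP in
/-- `Summable` form: the Eisenstein sections of `ω(r_F γ)Ψ` are summable iff those of `Ψ` are (`γ ∈ H`).
[cite: Weil1965, n° 39 (30) p. 57] -/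
theorem summable_eisTerm_omega_ratThetaLiftCont_iff {γ : Matrix.symplecticGroup (Fin (n + n)) F} (hγ : γ ∈ H)
    (Ψ : piSchwartzBruhat F (Fin (n + n))) :
    Summable (fun q : H ⧸ P.subgroupOf H =>
        ((adelicMpCont.omega F (Fin (n + n)) (doubledGramFin F T) (doublingDeltaLift F T hT)
            (adelicMpCont.omega F (Fin (n + n)) (doubledGramFin F T)
              (ratThetaLiftCont F (doubledGramFin F T) (isUnit_det_doubledGramFin F T hT)
                ((Quotient.out q : H) : Matrix.symplecticGroup (Fin (n + n)) F)⁻¹)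
              (adelicMpCont.omega F (Fin (n + n)) (doubledGramFin F T)
                (ratThetaLiftCont F (doubledGramFin F T) (isUnit_det_doubledGramFin F T hT) γ) Ψ)) :
            piSchwartzBruhat F (Fin (n + n))) : (Fin (n + n) → AdeleRing (𝓞 F) F) → ℂ) 0) ↔
      Summable (fun q : H ⧸ P.subgroupOf H =>
        ((adelicMpCont.omega F (Fin (n + n)) (doubledGramFin F T) (doublingDeltaLift F T hT)
            (adelicMpCont.omega F (Fin (n + n)) (doubledGramFin F T)
              (ratThetaLiftCont F (doubledGramFin F T) (isUnit_det_doubledGramFin F T hT)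
                ((Quotient.out q : H) : Matrix.symplecticGroup (Fin (n + n)) F)⁻¹) Ψ) :
            piSchwartzBruhat F (Fin (n + n))) : (Fin (n + n) → AdeleRing (𝓞 F) F) → ℂ) 0) :=
  SiegelEisenstein.summable_quotient_act_iff_of_mem
    (fun (a : Matrix.symplecticGroup (Fin (n + n)) F) (Φ : piSchwartzBruhat F (Fin (n + n))) =>
      adelicMpCont.omega F (Fin (n + n)) (doubledGramFin F T)
        (ratThetaLiftCont F (doubledGramFin F T) (isUnit_det_doubledGramFin F T hT) a) Φ)
    H P
    (fun Φ : piSchwartzBruhat F (Fin (n + n)) =>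
      ((adelicMpCont.omega F (Fin (n + n)) (doubledGramFin F T) (doublingDeltaLift F T hT) Φ :
        piSchwartzBruhat F (Fin (n + n))) : (Fin (n + n) → AdeleRing (𝓞 F) F) → ℂ) 0)
    (omega_ratThetaLiftCont_mul_apply F T hT)
    (fun _ hp Φ => apply_zero_omega_doublingDeltaLift_omega_ratThetaLiftCont_of_mem F T hT P hP hp Φ) hγ Ψ

/-- **`hP` for the child's `stabDiagRat`** — `PW = δ⁻¹ P_𝕐(F) δ` as the double `comap`, unfolded: membership IS the hypothesis `hP`
(two `Subgroup.mem_comap`). [cite: Li1992, p. 181] -/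
theorem mem_siegelParabolicPi_of_mem_comap_conj {p : Matrix.symplecticGroup (Fin (n + n)) F}
    (hp : p ∈ (((siegelParabolicPi (doubledGramFin F T)).comap
        (ratSp F (doubledGramFin F T) (isUnit_det_doubledGramFin F T hT))).comap
          (MulAut.conj (doublingDeltaRat F (n := n))).toMonoidHom)) :
    ratSp F (doubledGramFin F T) (isUnit_det_doubledGramFin F T hT) (doublingDeltaRat F * p * (doublingDeltaRat F)⁻¹) ∈
      siegelParabolicPi (doubledGramFin F T) :=
  Subgroup.mem_comap.mp (Subgroup.mem_comap.mp hp)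

end Eisenstein

/-! ## §3 Frame transfer (abstract): `(EI − κ₀ • EE) ∘ ω(r⁻¹) = EI − κ₀ • EE` for `r = u₀ · r_F(δ γ δ⁻¹) · u₀⁻¹` -/

section Transfer

variable (F : Type) [Field F] [NumberField F]


/-- **FRAME TRANSFER (abstract)**: let `I, Eis : 𝒮(X□(𝔸)) → ℂ` be two functionals invariant under `ω(r_F γ⁻¹)` and read in the geometric
frame through linear `EI, EE` as `I Ψ = κ₀·Ψ♮(0) + EI(Ψ♮)`, `Eis Ψ = Ψ♮(0) + EE(Ψ♮)` (BOTH rank-0 terms present); then for a frame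
pair `u₀` (`ω(u₀) = t(C₀)`) and `r := u₀ · r_F(δ γ δ⁻¹) · u₀⁻¹`, `(EI − κ₀ • EE) ∘ ω(r⁻¹) = EI − κ₀ • EE`: the frame is onto (§1),
`ω(r⁻¹)Ψ♮ = (ω(r_F γ⁻¹)Ψ)♮`, and `(EI − κ₀ • EE)(Ψ♮) = I Ψ − κ₀·Eis Ψ`. [cite: Weil1965, n° 41 and n° 51–52] -/
theorem sub_smul_comp_omega_inv_conj_eq_of_frame {m : ℕ} (T : Matrix (Fin m) (Fin m) (AdeleRing (𝓞 F) F)) (hT : IsUnit T.det)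
    (u₀ : adelicMpCont F (Fin (m + m)) (doubledGramFin F T))
    (hu₀ : ∀ Φ : piSchwartzBruhat F (Fin (m + m)),
      ((adelicMpCont.omega F (Fin (m + m)) (doubledGramFin F T) u₀ Φ : piSchwartzBruhat F (Fin (m + m))) :
          (Fin (m + m) → AdeleRing (𝓞 F) F) → ℂ) =
        chirp F (ratMatrix F (frameHalfRat F)) (Φ : (Fin (m + m) → AdeleRing (𝓞 F) F) → ℂ))
    (γ : Matrix.symplecticGroup (Fin (m + m)) F) (I Eis : piSchwartzBruhat F (Fin (m + m)) → ℂ)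
    (hIinv : ∀ Ψ, I (adelicMpCont.omega F (Fin (m + m)) (doubledGramFin F T)
      (ratThetaLiftCont F (doubledGramFin F T) (isUnit_det_doubledGramFin F T hT) γ⁻¹) Ψ) = I Ψ)
    (hEinv : ∀ Ψ, Eis (adelicMpCont.omega F (Fin (m + m)) (doubledGramFin F T)
      (ratThetaLiftCont F (doubledGramFin F T) (isUnit_det_doubledGramFin F T hT) γ⁻¹) Ψ) = Eis Ψ)
    (EI EE : piSchwartzBruhat F (Fin (m + m)) →ₗ[ℂ] ℂ) (κ₀ : ℂ)
    (hI : ∀ Ψ, I Ψ = κ₀ * ((geomFrame F T hT Ψ : piSchwartzBruhat F (Fin (m + m))) : (Fin (m + m) → AdeleRing (𝓞 F) F) → ℂ) 0 +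
      EI (geomFrame F T hT Ψ))
    (hE : ∀ Ψ, Eis Ψ = ((geomFrame F T hT Ψ : piSchwartzBruhat F (Fin (m + m))) : (Fin (m + m) → AdeleRing (𝓞 F) F) → ℂ) 0 +
      EE (geomFrame F T hT Ψ)) :
    (EI - κ₀ • EE) ∘ₗ adelicMpCont.omega F (Fin (m + m)) (doubledGramFin F T)
        (u₀ * ratThetaLiftCont F (doubledGramFin F T) (isUnit_det_doubledGramFin F T hT)
            (doublingDeltaRat F * γ * (doublingDeltaRat F)⁻¹) * u₀⁻¹)⁻¹ =
      EI - κ₀ • EE := by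
  -- `(EI − κ₀ • EE)(Ψ♮) = I Ψ − κ₀ · Eis Ψ`
  have hD : ∀ Ψ : piSchwartzBruhat F (Fin (m + m)), (EI - κ₀ • EE) (geomFrame F T hT Ψ) = I Ψ - κ₀ * Eis Ψ := fun Ψ => by
    rw [LinearMap.sub_apply, LinearMap.smul_apply, smul_eq_mul, hI Ψ, hE Ψ]
    ring
  -- the identity on every `Ψ♮`
  have hpt : ∀ Ψ : piSchwartzBruhat F (Fin (m + m)),
      ((EI - κ₀ • EE) ∘ₗ adelicMpCont.omega F (Fin (m + m)) (doubledGramFin F T)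
          (u₀ * ratThetaLiftCont F (doubledGramFin F T) (isUnit_det_doubledGramFin F T hT)
              (doublingDeltaRat F * γ * (doublingDeltaRat F)⁻¹) * u₀⁻¹)⁻¹) (geomFrame F T hT Ψ) =
        (EI - κ₀ • EE) (geomFrame F T hT Ψ) := fun Ψ =>
    (LinearMap.comp_apply (EI - κ₀ • EE) _ (geomFrame F T hT Ψ)).trans
      ((congrArg (EI - κ₀ • EE) (omega_inv_conj_geomFrame F T hT u₀ hu₀ γ Ψ)).trans
        ((hD _).trans ((congrArg₂ (fun a b : ℂ => a - κ₀ * b) (hIinv Ψ) (hEinv Ψ)).trans (hD Ψ).symm)))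
  -- the frame is onto
  refine LinearMap.ext fun Φ => ?_
  exact (exists_eq_geomFrame F T hT u₀ hu₀ Φ).elim fun Ψ hΨ =>
    (congrArg ((EI - κ₀ • EE) ∘ₗ adelicMpCont.omega F (Fin (m + m)) (doubledGramFin F T)
        (u₀ * ratThetaLiftCont F (doubledGramFin F T) (isUnit_det_doubledGramFin F T hT)
            (doublingDeltaRat F * γ * (doublingDeltaRat F)⁻¹) * u₀⁻¹)⁻¹) hΨ).trans
      ((hpt Ψ).trans (congrArg (EI - κ₀ • EE) hΨ).symm)

end Transfer

end Literature.NumberTheory.Weil1964.DoublingFrame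

end
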